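import Summits.Ventures.CertifiedManyBodySolver.Downfold.EmeryAxialSlabBi2201SubsA
import Summits.Ventures.CertifiedManyBodySolver.Downfold.EmeryAxialSlabBi2201SubsC
import Summits.Ventures.CertifiedManyBodySolver.Downfold.EmeryAxialSlabBi2201SubsB
import Summits.Ventures.CertifiedManyBodySolver.Downfold.EmeryFermiFillingLa214
import HarnessLib

/-!
# Bi₂Sr₂CuO₆₊δ (box #61 Bi-2201, Morée 2022 source rows): HOW MUCH AXIAL (Cu-4s / apical) ADMIXTURE DOES THE BOX'S ONE-BAND FERMI SURFACE REQUIRE? — the certified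
# co-shift census of the typed 3BE one-body box `emeryBoxBi2201M61MoreePPSrc` against its object-E row `t′/t ∈ [-0.411, -0.31]`

Venture CertifiedManyBodySolver, cell `pub/hubbard-downfold` (stage S1, HUMAN RULINGS D-0096/D-0098: the 3 → 1 reduction error is carried explicitly),
seat hubbard-downfold-mod-4 (technique B = band level); namespace `Summit.Ventures.CertifiedManyBodySolver.Downfold.Emery`. Everything PROVED; numerics
decided by the kernel in `EmeryAxialSlabBi2201SubsA`, `EmeryAxialSlabBi2201SubsC`, `EmeryAxialSlabBi2201SubsB`.

CONTEXT. `EmeryFermiFillingBi2201…` certified the σ three-band (d–p_x–p_y + t_pp, t_pp′) Fermi-surface `t′/t` window of this box at its own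
hole count and compared it with the box's object-E row (router/BOXES/Bi2Sr2CuO6.md l.26 «tp/t (E) [−0.411, −0.310]»). `EmeryAxialFermiSurfaceShape` +
`EmeryAxialConductionBand` (TRANSFER THEOREM `condBand_le_iff`, no separation hypothesis) prove that the four-orbital model of [AndersenEtAl1995] /
[PavariniEtAl2001] — Cu-4s (and through it the apical orbitals) added to the σ model — has, AT ITS FERMI LEVEL, exactly the conduction-band occupied
set, filling and Fermi surface of the σ model with CO-SHIFTED O–O hoppings `(t_pp + a, t_pp′ + a)`, ONE scalar `a = a_F = t_sp²/(ε_s − ε_F) ≥ 0`.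
So «how much axial channel does the one-band FS of record require beyond the box's σ rows?» is a one-parameter question, answered here slab by slab
(sub-box rule version B, `EmeryFermiFillingSubBoxB`; edges 0, 0.1, 0.2, 0.3, 0.4, 0.5, 0.6 eV; Δ_pd × t_pd split 2 × 2):

| slab | a (eV) | ε_F window (eV above ε_d) | certified t′/t window | vs E row [-0.411, -0.31] |
|---|---|---|---|---|
| 0 | [0, 0.1] | [1.24, 2.38] | [-0.3597, -0.2443] | MEETS |
| 1 | [0.1, 0.2] | [1.2, 2.32] | [-0.3956, -0.2887] | MEETS |
| 2 | [0.2, 0.3] | [1.16, 2.24] | [-0.4265, -0.3214] | MEETS |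
| 3 | [0.3, 0.4] | [1.14, 2.24] | [-0.4526, -0.3476] | MEETS |
| 4 | [0.4, 0.5] | [1.1, 2.18] | [-0.4733, -0.3698] | MEETS |
| 5 | [0.5, 0.6] | [1.08, 2.12] | [-0.4931, -0.3881] | MEETS |

READING (certified, numbers not adjectives): every slab MEETS the E row (no exclusion certified at this resolution). The four-orbital form of the exclusion(s) is `emeryBoxBi2201M61MoreePPSrc_fourOrbital_short`:
for ANY axial level `ε_s` and coupling `t_sp`, a four-orbital completion of a box point whose conduction band holds the box's electrons at a Fermi level `ε_F < ε_s`
with `t_sp²/(ε_s − ε_F)` in the excluded range does NOT reproduce the E row. (Pavarini's range parameter for the PURE four-orbital model is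
`r = ½/(1 + s)`, `s = (ε_s − ε_F)(ε_F − ε_p)/(2t_sp)² = (ε_F + Δ_pd)/(4·a_total)`, where `a_total` would be the WHOLE O–O co-shift; the box's `t_pp, t_pp′` rows
already contain part of the axial channel when they come from a three-band Wannier fit, so `a_F` here is the ADDITIONAL admixture — a model-form
distance, not a material constant.)

WHAT THIS IS NOT: not a statement that the material's parameters ARE in the box (SCREENING-GRADE provenance); `U = 0` band kinematics; no phase
sentence; the E row is a [float] literature refit. Sources: [AndersenEtAl1995, §§5–6]; [PavariniEtAl2001, Eqs. (1)–(3), Fig. 3];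
[HybertsenSchluterChristensen1989, Eq. (1)].
-/

noncomputable section

namespace Summit.Ventures.CertifiedManyBodySolver.Downfold.Emery

open Real Set
open Summit.Ventures.CertifiedManyBodySolver.Downfold

/-! ## §1 Slab windows (raw co-shifted coordinates `t_pp′ := t_pp + a`, `c′ := t_pp′ + a`) -/

/-- **Slab 0, a ∈ [0, 0.1] eV**: on the co-shifted box (t_pp + a ∈ [0.62, 0.84], t_pp′ + a ∈ [0.14, 0.27]) at per-spin
filling ∈ [0.412, 0.428]: `ε_F ∈ [1.24, 2.38]` and `t′/t ∈ [-0.3597, -0.2443]` — MEETS vs the E row. [folklore] -/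
theorem bi2201AxSlab0_window {Δ tpd tpp c ε : ℝ} (hΔ : Δ ∈ Set.Icc (44 / 25 : ℝ) (59 / 25 : ℝ))
    (ha : tpd ∈ Set.Icc (5 / 4 : ℝ) (147 / 100 : ℝ)) (hb : tpp ∈ Set.Icc (31 / 50 : ℝ) (21 / 25 : ℝ))
    (hc : c ∈ Set.Icc (7 / 50 : ℝ) (27 / 100 : ℝ))
    (hν : abFilling Δ tpd tpp c ε ∈ Set.Icc (103 / 250 : ℝ) (107 / 250 : ℝ)) :
    ε ∈ Set.Icc (31 / 25 : ℝ) (119 / 50 : ℝ) ∧ fsRatio Δ tpd tpp c ε ∈ Set.Icc (-(3597 / 10000 : ℝ)) (-(2443 / 10000 : ℝ)) := by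
  have hΔ' := hΔ
  constructor
  · clear hΔ
    rcases mem_Icc_split hΔ' (103 / 50 : ℝ) with hΔ' | hΔ'
    · rcases mem_Icc_split ha (34 / 25 : ℝ) with ha' | ha'
      · have h := (bi2201Ax0Sub_0_0 hΔ' ha' hb hc hν).1
        exact ⟨le_trans (by norm_num) h.1, h.2.trans (by norm_num)⟩
      · have h := (bi2201Ax0Sub_0_1 hΔ' ha' hb hc hν).1
        exact ⟨le_trans (by norm_num) h.1, h.2.trans (by norm_num)⟩
    · rcases mem_Icc_split ha (34 / 25 : ℝ) with ha' | ha'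
      · have h := (bi2201Ax0Sub_1_0 hΔ' ha' hb hc hν).1
        exact ⟨le_trans (by norm_num) h.1, h.2.trans (by norm_num)⟩
      · have h := (bi2201Ax0Sub_1_1 hΔ' ha' hb hc hν).1
        exact ⟨le_trans (by norm_num) h.1, h.2.trans (by norm_num)⟩
  · clear hΔ
    rcases mem_Icc_split hΔ' (103 / 50 : ℝ) with hΔ' | hΔ'
    · rcases mem_Icc_split ha (34 / 25 : ℝ) with ha' | ha'
      · have h := (bi2201Ax0Sub_0_0 hΔ' ha' hb hc hν).2
        exact ⟨le_trans (by norm_num) h.1, h.2.trans (by norm_num)⟩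
      · have h := (bi2201Ax0Sub_0_1 hΔ' ha' hb hc hν).2
        exact ⟨le_trans (by norm_num) h.1, h.2.trans (by norm_num)⟩
    · rcases mem_Icc_split ha (34 / 25 : ℝ) with ha' | ha'
      · have h := (bi2201Ax0Sub_1_0 hΔ' ha' hb hc hν).2
        exact ⟨le_trans (by norm_num) h.1, h.2.trans (by norm_num)⟩
      · have h := (bi2201Ax0Sub_1_1 hΔ' ha' hb hc hν).2
        exact ⟨le_trans (by norm_num) h.1, h.2.trans (by norm_num)⟩

/-- **Slab 1, a ∈ [0.1, 0.2] eV**: on the co-shifted box (t_pp + a ∈ [0.72, 0.94], t_pp′ + a ∈ [0.24, 0.37]) at per-spin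
filling ∈ [0.412, 0.428]: `ε_F ∈ [1.2, 2.32]` and `t′/t ∈ [-0.3956, -0.2887]` — MEETS vs the E row. [folklore] -/
theorem bi2201AxSlab1_window {Δ tpd tpp c ε : ℝ} (hΔ : Δ ∈ Set.Icc (44 / 25 : ℝ) (59 / 25 : ℝ))
    (ha : tpd ∈ Set.Icc (5 / 4 : ℝ) (147 / 100 : ℝ)) (hb : tpp ∈ Set.Icc (18 / 25 : ℝ) (47 / 50 : ℝ))
    (hc : c ∈ Set.Icc (6 / 25 : ℝ) (37 / 100 : ℝ))
    (hν : abFilling Δ tpd tpp c ε ∈ Set.Icc (103 / 250 : ℝ) (107 / 250 : ℝ)) :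
    ε ∈ Set.Icc (6 / 5 : ℝ) (58 / 25 : ℝ) ∧ fsRatio Δ tpd tpp c ε ∈ Set.Icc (-(989 / 2500 : ℝ)) (-(2887 / 10000 : ℝ)) := by
  have hΔ' := hΔ
  constructor
  · clear hΔ
    rcases mem_Icc_split hΔ' (103 / 50 : ℝ) with hΔ' | hΔ'
    · rcases mem_Icc_split ha (34 / 25 : ℝ) with ha' | ha'
      · have h := (bi2201Ax1Sub_0_0 hΔ' ha' hb hc hν).1
        exact ⟨le_trans (by norm_num) h.1, h.2.trans (by norm_num)⟩
      · have h := (bi2201Ax1Sub_0_1 hΔ' ha' hb hc hν).1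
        exact ⟨le_trans (by norm_num) h.1, h.2.trans (by norm_num)⟩
    · rcases mem_Icc_split ha (34 / 25 : ℝ) with ha' | ha'
      · have h := (bi2201Ax1Sub_1_0 hΔ' ha' hb hc hν).1
        exact ⟨le_trans (by norm_num) h.1, h.2.trans (by norm_num)⟩
      · have h := (bi2201Ax1Sub_1_1 hΔ' ha' hb hc hν).1
        exact ⟨le_trans (by norm_num) h.1, h.2.trans (by norm_num)⟩
  · clear hΔ
    rcases mem_Icc_split hΔ' (103 / 50 : ℝ) with hΔ' | hΔ'
    · rcases mem_Icc_split ha (34 / 25 : ℝ) with ha' | ha'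
      · have h := (bi2201Ax1Sub_0_0 hΔ' ha' hb hc hν).2
        exact ⟨le_trans (by norm_num) h.1, h.2.trans (by norm_num)⟩
      · have h := (bi2201Ax1Sub_0_1 hΔ' ha' hb hc hν).2
        exact ⟨le_trans (by norm_num) h.1, h.2.trans (by norm_num)⟩
    · rcases mem_Icc_split ha (34 / 25 : ℝ) with ha' | ha'
      · have h := (bi2201Ax1Sub_1_0 hΔ' ha' hb hc hν).2
        exact ⟨le_trans (by norm_num) h.1, h.2.trans (by norm_num)⟩
      · have h := (bi2201Ax1Sub_1_1 hΔ' ha' hb hc hν).2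
        exact ⟨le_trans (by norm_num) h.1, h.2.trans (by norm_num)⟩

/-- **Slab 2, a ∈ [0.2, 0.3] eV**: on the co-shifted box (t_pp + a ∈ [0.82, 1.04], t_pp′ + a ∈ [0.34, 0.47]) at per-spin
filling ∈ [0.412, 0.428]: `ε_F ∈ [1.16, 2.24]` and `t′/t ∈ [-0.4265, -0.3214]` — MEETS vs the E row. [folklore] -/
theorem bi2201AxSlab2_window {Δ tpd tpp c ε : ℝ} (hΔ : Δ ∈ Set.Icc (44 / 25 : ℝ) (59 / 25 : ℝ))
    (ha : tpd ∈ Set.Icc (5 / 4 : ℝ) (147 / 100 : ℝ)) (hb : tpp ∈ Set.Icc (41 / 50 : ℝ) (26 / 25 : ℝ))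
    (hc : c ∈ Set.Icc (17 / 50 : ℝ) (47 / 100 : ℝ))
    (hν : abFilling Δ tpd tpp c ε ∈ Set.Icc (103 / 250 : ℝ) (107 / 250 : ℝ)) :
    ε ∈ Set.Icc (29 / 25 : ℝ) (56 / 25 : ℝ) ∧ fsRatio Δ tpd tpp c ε ∈ Set.Icc (-(853 / 2000 : ℝ)) (-(1607 / 5000 : ℝ)) := by
  have hΔ' := hΔ
  constructor
  · clear hΔ
    rcases mem_Icc_split hΔ' (103 / 50 : ℝ) with hΔ' | hΔ'
    · rcases mem_Icc_split ha (34 / 25 : ℝ) with ha' | ha'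
      · have h := (bi2201Ax2Sub_0_0 hΔ' ha' hb hc hν).1
        exact ⟨le_trans (by norm_num) h.1, h.2.trans (by norm_num)⟩
      · have h := (bi2201Ax2Sub_0_1 hΔ' ha' hb hc hν).1
        exact ⟨le_trans (by norm_num) h.1, h.2.trans (by norm_num)⟩
    · rcases mem_Icc_split ha (34 / 25 : ℝ) with ha' | ha'
      · have h := (bi2201Ax2Sub_1_0 hΔ' ha' hb hc hν).1
        exact ⟨le_trans (by norm_num) h.1, h.2.trans (by norm_num)⟩
      · have h := (bi2201Ax2Sub_1_1 hΔ' ha' hb hc hν).1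
        exact ⟨le_trans (by norm_num) h.1, h.2.trans (by norm_num)⟩
  · clear hΔ
    rcases mem_Icc_split hΔ' (103 / 50 : ℝ) with hΔ' | hΔ'
    · rcases mem_Icc_split ha (34 / 25 : ℝ) with ha' | ha'
      · have h := (bi2201Ax2Sub_0_0 hΔ' ha' hb hc hν).2
        exact ⟨le_trans (by norm_num) h.1, h.2.trans (by norm_num)⟩
      · have h := (bi2201Ax2Sub_0_1 hΔ' ha' hb hc hν).2
        exact ⟨le_trans (by norm_num) h.1, h.2.trans (by norm_num)⟩
    · rcases mem_Icc_split ha (34 / 25 : ℝ) with ha' | ha'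
      · have h := (bi2201Ax2Sub_1_0 hΔ' ha' hb hc hν).2
        exact ⟨le_trans (by norm_num) h.1, h.2.trans (by norm_num)⟩
      · have h := (bi2201Ax2Sub_1_1 hΔ' ha' hb hc hν).2
        exact ⟨le_trans (by norm_num) h.1, h.2.trans (by norm_num)⟩

/-- **Slab 3, a ∈ [0.3, 0.4] eV**: on the co-shifted box (t_pp + a ∈ [0.92, 1.14], t_pp′ + a ∈ [0.44, 0.57]) at per-spin
filling ∈ [0.412, 0.428]: `ε_F ∈ [1.14, 2.24]` and `t′/t ∈ [-0.4526, -0.3476]` — MEETS vs the E row. [folklore] -/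
theorem bi2201AxSlab3_window {Δ tpd tpp c ε : ℝ} (hΔ : Δ ∈ Set.Icc (44 / 25 : ℝ) (59 / 25 : ℝ))
    (ha : tpd ∈ Set.Icc (5 / 4 : ℝ) (147 / 100 : ℝ)) (hb : tpp ∈ Set.Icc (23 / 25 : ℝ) (57 / 50 : ℝ))
    (hc : c ∈ Set.Icc (11 / 25 : ℝ) (57 / 100 : ℝ))
    (hν : abFilling Δ tpd tpp c ε ∈ Set.Icc (103 / 250 : ℝ) (107 / 250 : ℝ)) :
    ε ∈ Set.Icc (57 / 50 : ℝ) (56 / 25 : ℝ) ∧ fsRatio Δ tpd tpp c ε ∈ Set.Icc (-(2263 / 5000 : ℝ)) (-(869 / 2500 : ℝ)) := by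
  have hΔ' := hΔ
  constructor
  · clear hΔ
    rcases mem_Icc_split hΔ' (103 / 50 : ℝ) with hΔ' | hΔ'
    · rcases mem_Icc_split ha (34 / 25 : ℝ) with ha' | ha'
      · have h := (bi2201Ax3Sub_0_0 hΔ' ha' hb hc hν).1
        exact ⟨le_trans (by norm_num) h.1, h.2.trans (by norm_num)⟩
      · have h := (bi2201Ax3Sub_0_1 hΔ' ha' hb hc hν).1
        exact ⟨le_trans (by norm_num) h.1, h.2.trans (by norm_num)⟩
    · rcases mem_Icc_split ha (34 / 25 : ℝ) with ha' | ha'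
      · have h := (bi2201Ax3Sub_1_0 hΔ' ha' hb hc hν).1
        exact ⟨le_trans (by norm_num) h.1, h.2.trans (by norm_num)⟩
      · have h := (bi2201Ax3Sub_1_1 hΔ' ha' hb hc hν).1
        exact ⟨le_trans (by norm_num) h.1, h.2.trans (by norm_num)⟩
  · clear hΔ
    rcases mem_Icc_split hΔ' (103 / 50 : ℝ) with hΔ' | hΔ'
    · rcases mem_Icc_split ha (34 / 25 : ℝ) with ha' | ha'
      · have h := (bi2201Ax3Sub_0_0 hΔ' ha' hb hc hν).2
        exact ⟨le_trans (by norm_num) h.1, h.2.trans (by norm_num)⟩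
      · have h := (bi2201Ax3Sub_0_1 hΔ' ha' hb hc hν).2
        exact ⟨le_trans (by norm_num) h.1, h.2.trans (by norm_num)⟩
    · rcases mem_Icc_split ha (34 / 25 : ℝ) with ha' | ha'
      · have h := (bi2201Ax3Sub_1_0 hΔ' ha' hb hc hν).2
        exact ⟨le_trans (by norm_num) h.1, h.2.trans (by norm_num)⟩
      · have h := (bi2201Ax3Sub_1_1 hΔ' ha' hb hc hν).2
        exact ⟨le_trans (by norm_num) h.1, h.2.trans (by norm_num)⟩

/-- **Slab 4, a ∈ [0.4, 0.5] eV**: on the co-shifted box (t_pp + a ∈ [1.02, 1.24], t_pp′ + a ∈ [0.54, 0.67]) at per-spin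
filling ∈ [0.412, 0.428]: `ε_F ∈ [1.1, 2.18]` and `t′/t ∈ [-0.4733, -0.3698]` — MEETS vs the E row. [folklore] -/
theorem bi2201AxSlab4_window {Δ tpd tpp c ε : ℝ} (hΔ : Δ ∈ Set.Icc (44 / 25 : ℝ) (59 / 25 : ℝ))
    (ha : tpd ∈ Set.Icc (5 / 4 : ℝ) (147 / 100 : ℝ)) (hb : tpp ∈ Set.Icc (51 / 50 : ℝ) (31 / 25 : ℝ))
    (hc : c ∈ Set.Icc (27 / 50 : ℝ) (67 / 100 : ℝ))
    (hν : abFilling Δ tpd tpp c ε ∈ Set.Icc (103 / 250 : ℝ) (107 / 250 : ℝ)) :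
    ε ∈ Set.Icc (11 / 10 : ℝ) (109 / 50 : ℝ) ∧ fsRatio Δ tpd tpp c ε ∈ Set.Icc (-(4733 / 10000 : ℝ)) (-(1849 / 5000 : ℝ)) := by
  have hΔ' := hΔ
  constructor
  · clear hΔ
    rcases mem_Icc_split hΔ' (103 / 50 : ℝ) with hΔ' | hΔ'
    · rcases mem_Icc_split ha (34 / 25 : ℝ) with ha' | ha'
      · have h := (bi2201Ax4Sub_0_0 hΔ' ha' hb hc hν).1
        exact ⟨le_trans (by norm_num) h.1, h.2.trans (by norm_num)⟩
      · have h := (bi2201Ax4Sub_0_1 hΔ' ha' hb hc hν).1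
        exact ⟨le_trans (by norm_num) h.1, h.2.trans (by norm_num)⟩
    · rcases mem_Icc_split ha (34 / 25 : ℝ) with ha' | ha'
      · have h := (bi2201Ax4Sub_1_0 hΔ' ha' hb hc hν).1
        exact ⟨le_trans (by norm_num) h.1, h.2.trans (by norm_num)⟩
      · have h := (bi2201Ax4Sub_1_1 hΔ' ha' hb hc hν).1
        exact ⟨le_trans (by norm_num) h.1, h.2.trans (by norm_num)⟩
  · clear hΔ
    rcases mem_Icc_split hΔ' (103 / 50 : ℝ) with hΔ' | hΔ'
    · rcases mem_Icc_split ha (34 / 25 : ℝ) with ha' | ha'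
      · have h := (bi2201Ax4Sub_0_0 hΔ' ha' hb hc hν).2
        exact ⟨le_trans (by norm_num) h.1, h.2.trans (by norm_num)⟩
      · have h := (bi2201Ax4Sub_0_1 hΔ' ha' hb hc hν).2
        exact ⟨le_trans (by norm_num) h.1, h.2.trans (by norm_num)⟩
    · rcases mem_Icc_split ha (34 / 25 : ℝ) with ha' | ha'
      · have h := (bi2201Ax4Sub_1_0 hΔ' ha' hb hc hν).2
        exact ⟨le_trans (by norm_num) h.1, h.2.trans (by norm_num)⟩
      · have h := (bi2201Ax4Sub_1_1 hΔ' ha' hb hc hν).2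
        exact ⟨le_trans (by norm_num) h.1, h.2.trans (by norm_num)⟩

/-- **Slab 5, a ∈ [0.5, 0.6] eV**: on the co-shifted box (t_pp + a ∈ [1.12, 1.34], t_pp′ + a ∈ [0.64, 0.77]) at per-spin
filling ∈ [0.412, 0.428]: `ε_F ∈ [1.08, 2.12]` and `t′/t ∈ [-0.4931, -0.3881]` — MEETS vs the E row. [folklore] -/
theorem bi2201AxSlab5_window {Δ tpd tpp c ε : ℝ} (hΔ : Δ ∈ Set.Icc (44 / 25 : ℝ) (59 / 25 : ℝ))
    (ha : tpd ∈ Set.Icc (5 / 4 : ℝ) (147 / 100 : ℝ)) (hb : tpp ∈ Set.Icc (28 / 25 : ℝ) (67 / 50 : ℝ))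
    (hc : c ∈ Set.Icc (16 / 25 : ℝ) (77 / 100 : ℝ))
    (hν : abFilling Δ tpd tpp c ε ∈ Set.Icc (103 / 250 : ℝ) (107 / 250 : ℝ)) :
    ε ∈ Set.Icc (27 / 25 : ℝ) (53 / 25 : ℝ) ∧ fsRatio Δ tpd tpp c ε ∈ Set.Icc (-(4931 / 10000 : ℝ)) (-(3881 / 10000 : ℝ)) := by
  have hΔ' := hΔ
  constructor
  · clear hΔ
    rcases mem_Icc_split hΔ' (103 / 50 : ℝ) with hΔ' | hΔ'
    · rcases mem_Icc_split ha (34 / 25 : ℝ) with ha' | ha'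
      · have h := (bi2201Ax5Sub_0_0 hΔ' ha' hb hc hν).1
        exact ⟨le_trans (by norm_num) h.1, h.2.trans (by norm_num)⟩
      · have h := (bi2201Ax5Sub_0_1 hΔ' ha' hb hc hν).1
        exact ⟨le_trans (by norm_num) h.1, h.2.trans (by norm_num)⟩
    · rcases mem_Icc_split ha (34 / 25 : ℝ) with ha' | ha'
      · have h := (bi2201Ax5Sub_1_0 hΔ' ha' hb hc hν).1
        exact ⟨le_trans (by norm_num) h.1, h.2.trans (by norm_num)⟩
      · have h := (bi2201Ax5Sub_1_1 hΔ' ha' hb hc hν).1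
        exact ⟨le_trans (by norm_num) h.1, h.2.trans (by norm_num)⟩
  · clear hΔ
    rcases mem_Icc_split hΔ' (103 / 50 : ℝ) with hΔ' | hΔ'
    · rcases mem_Icc_split ha (34 / 25 : ℝ) with ha' | ha'
      · have h := (bi2201Ax5Sub_0_0 hΔ' ha' hb hc hν).2
        exact ⟨le_trans (by norm_num) h.1, h.2.trans (by norm_num)⟩
      · have h := (bi2201Ax5Sub_0_1 hΔ' ha' hb hc hν).2
        exact ⟨le_trans (by norm_num) h.1, h.2.trans (by norm_num)⟩
    · rcases mem_Icc_split ha (34 / 25 : ℝ) with ha' | ha'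
      · have h := (bi2201Ax5Sub_1_0 hΔ' ha' hb hc hν).2
        exact ⟨le_trans (by norm_num) h.1, h.2.trans (by norm_num)⟩
      · have h := (bi2201Ax5Sub_1_1 hΔ' ha' hb hc hν).2
        exact ⟨le_trans (by norm_num) h.1, h.2.trans (by norm_num)⟩

end Summit.Ventures.CertifiedManyBodySolver.Downfold.Emery
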